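import Literature.AnabelianGeometry.SemiGraphs.SgAToProfiniteCompare
import Literature.AnabelianGeometry.Anabelioids.FiniteEtaleProofs
import Literature.AnabelianGeometry.Anabelioids.FiniteEtaleComposition
import HarnessLib

/-!
# [GeoAn] Rmk 1.2.2.1 for ABSTRACT connected anabelioids: `π₁(φ)` injective with open image ⇒ `φ`
# finite étale (bridge B5, proof-only) — read through the fibre-functor equivalences

Mochizuki, *The geometry of anabelioids*, Publ. RIMS **40** (2004), Rmk 1.2.2.1 p. 17: "the
morphism `B(H) → B(G)` induced by a continuous homomorphism `φ : H → G` is finite étale if and only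
if `φ` is an injection onto an open subgroup of `G`" [cite: MochizukiGeoAn2004, Rem. 1.2.2.1 p.17];
[SemiAnbd] §2 p. 23 (kurims `paper:url-f33ace170ff4`): constituent anabelioids are `B(Π_v)`,
`B(Π_e)` [cite: MochizukiSemiAnbd2006, Def. 2.1 p.23].

PROOF-ONLY (abc-iut-L3-t3 gen 5, step B5 of the (R1) bridge, HOME/staging/L3/L3-t3/
R1-BRIDGE-SHAPES.md §2 L2), over B1–B3 (`SgAToProfinite*.lean`) and abc-iut-L6-t17 /
`Anabelioids/FiniteEtaleProofs.lean` (`bCat_res_isFiniteEtale_iff_holds`, stated at `Type 0`):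

* `Anabelioids.homOfPath Q F_D α : Aut F_D →ₜ* Aut F_C` — `π₁(Q)` read along a path
  `α : Q ⋙ F_D ≅ F_C` (B1's `brHomOfPath` / B2's `hVOfPath` are instances);
* `Anabelioids.compareIsoOfPath` — THE GENERAL 2-CELL
  `functorToContAction F_C ⋙ res (homOfPath Q F_D α) ≅ Q ⋙ functorToContAction F_D`
  (B3's `compareBranchIso` is the instance `Q = b^*`): an exact functor between connected
  anabelioids IS, through the fibre-functor equivalences, restriction along `π₁`;
* `Anabelioids.isFiniteEtale_res_of_injective_of_isOpen'` — the (⇐) half of Rmk 1.2.2.1 at an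
  ARBITRARY universe (the tree's `bCat_res_isFiniteEtale_iff_holds` is the `Type 0` statement; same
  proof, through abc-iut's `Induction*.lean`: `B(G)_{/(G/U)} ≌ B(U)`);
* `Anabelioids.isFiniteEtale_of_pi1Map_injective_of_isOpen_range` — **for an exact functor
  `Q : C ⥤ D` between Galois categories, if `π₁(Q) : Aut F_D → Aut (Q ⋙ F_D)` is injective with open
  image then `Q` is (the pull-back functor of) a finite étale morphism** (`IsFiniteEtale Q`):
  transport of the previous item along `compareIsoOfPath` and the equivalences
  (`IsFiniteEtale.isEquivalence_comp` / `comp_isEquivalence` / `of_iso`, abc-iut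
  `FiniteEtaleComposition.lean`).

Nothing of [SemiAnbd] is asserted; no side taken on [IUTchIII] Cor. 3.12.
-/

noncomputable section

namespace Literature.AnabelianGeometry.Anabelioids

open CategoryTheory CategoryTheory.Limits CategoryTheory.PreGaloisCategory
open Literature.AnabelianGeometry.SemiGraphs (Aut.autMulEquivOfIso_apply_eq_conjAut
  Aut.continuousMulEquivOfIso Aut.continuousMulEquivOfIso_apply Aut.continuous_autMulEquivOfIso)
open Literature.AlgebraicGeometry.Frobenioids (BCat)
open scoped FintypeCatDiscrete
open Induction

universe u

/-! ### `π₁(Q)` along a path, and the general comparison 2-cell -/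

section Path

variable {C : Type u} [Category.{u} C] {D : Type u} [Category.{u} D] (Q : C ⥤ D)
  (FD : D ⥤ FintypeCat.{u}) {FC : C ⥤ FintypeCat.{u}} (α : Q ⋙ FD ≅ FC)

/-- `π₁(Q)` read along the path `α : Q ⋙ F_D ≅ F_C`: `Aut F_D → Aut (Q ⋙ F_D) ⥲ Aut F_C`, a
continuous homomorphism ([GeoAn] Def 1.1.2 (ii): induced morphism of fundamental groups at the
transported basepoint). [cite: MochizukiGeoAn2004, Def. 1.1.2(ii) p.10] -/
def homOfPath : Aut FD →ₜ* Aut FC :=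
  (Aut.continuousMulEquivOfIso α : _ →ₜ* _).comp
    { toMonoidHom := pi1Map Q FD, continuous_toFun := SemiGraphs.continuous_pi1Map _ _ }

/-- Pointwise formula. [cite: MochizukiGeoAn2004, Def. 1.1.2(ii) p.10] -/
@[simp] theorem homOfPath_apply (σ : Aut FD) :
    homOfPath Q FD α σ = Aut.autMulEquivOfIso α (pi1Map Q FD σ) := rfl

/-- The component at `A ∈ C` of the comparison 2-cell on underlying finite sets: `α_A⁻¹`.
[cite: MochizukiGeoAn2004, Def. 1.1.2(ii) p.10] -/
def compareFibreIsoOfPath (A : C) : FC.obj A ≅ FD.obj (Q.obj A) := (α.app A).symm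

/-- Equivariance of `α_A⁻¹`: acting by `homOfPath Q F_D α σ` on `F_C(A)` and then applying `α_A⁻¹`
is applying `α_A⁻¹` and then acting by `σ` on `F_D(Q A)`. [cite: MochizukiGeoAn2004, Def. 1.1.2(ii) p.10] -/
theorem compareFibreIsoOfPath_equivariant (A : C) (σ : Aut FD) (x : FC.obj A) :
    (compareFibreIsoOfPath Q FD α A).hom ((homOfPath Q FD α σ) • x) =
      σ • (compareFibreIsoOfPath Q FD α A).hom x := by
  rw [mulAction_def, mulAction_def, homOfPath_apply]
  change (α.app A).inv ((α.inv ≫ (pi1Map Q FD σ).hom ≫ α.hom).app A x) =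
    σ.hom.app (Q.obj A) ((α.app A).inv x)
  rw [NatTrans.comp_app, NatTrans.comp_app, pi1Map_hom_app]
  change (α.hom.app A ≫ α.inv.app A) (σ.hom.app (Q.obj A) (α.inv.app A x)) = _
  rw [Iso.hom_inv_id_app]
  rfl

variable [GaloisCategory C] [GaloisCategory D] [FiberFunctor FD] [FiberFunctor FC]

/-- The component at `A ∈ C` of the comparison 2-cell, as an isomorphism of continuous finite
`Aut F_D`-sets. [cite: MochizukiGeoAn2004, Def. 1.1.2(ii) p.10] -/
def compareIsoOfPathApp (A : C) :
    (functorToContAction FC ⋙ ContAction.res FintypeCat.{u} (homOfPath Q FD α)).obj A ≅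
      (Q ⋙ functorToContAction FD).obj A :=
  ObjectProperty.isoMk _ (Action.mkIso (compareFibreIsoOfPath Q FD α A) fun σ => by
    ext x
    exact compareFibreIsoOfPath_equivariant Q FD α A σ x)

/-- **The general comparison 2-cell**: for an exact functor `Q : C ⥤ D` between Galois categories
and a path `α : Q ⋙ F_D ≅ F_C`, `functorToContAction F_C ⋙ res (homOfPath Q F_D α) ≅
Q ⋙ functorToContAction F_D` — through the fibre-functor equivalences, `Q` IS restriction along
`π₁(Q)` (B3's `compareBranchIso` is the case `Q = b^*`). [cite: MochizukiGeoAn2004, Def. 1.1.2(ii) p.10] -/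
def compareIsoOfPath :
    functorToContAction FC ⋙ ContAction.res FintypeCat.{u} (homOfPath Q FD α) ≅
      Q ⋙ functorToContAction FD :=
  NatIso.ofComponents (fun A => compareIsoOfPathApp Q FD α A) fun {A A'} f => by
    apply ObjectProperty.hom_ext
    apply Action.Hom.ext
    ext x
    change (compareFibreIsoOfPath Q FD α A').hom (FC.map f x) =
      FD.map (Q.map f) ((compareFibreIsoOfPath Q FD α A).hom x)
    exact NatTrans.naturality_apply α.inv f x

end Path

/-! ### Rmk 1.2.2.1 (⇐) at an arbitrary universe -/

section ResFiniteEtale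

variable {G H : Type u} [Group G] [TopologicalSpace G] [IsTopologicalGroup G] [CompactSpace G]
  [T2Space G] [Group H] [TopologicalSpace H] [CompactSpace H] (φ : H →ₜ* G)

/-- **(⇐) of [GeoAn] Rmk 1.2.2.1, universe-polymorphic form**: if `φ : H → G` is injective with open
image `U`, then `res φ : B(G) ⥤ B(H)` is finite étale — `S = G/U`, `B(G)_{/S} ≌ B(U) ≌ B(H)`
(abc-iut `Induction*.lean`; the tree's `bCat_res_isFiniteEtale_iff_holds` is the `Type 0` statement
with the same proof). [cite: MochizukiGeoAn2004, Rem. 1.2.2.1 p.17] -/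
theorem isFiniteEtale_res_of_injective_of_isOpen' [HasBinaryProducts (BCat G)]
    (hinj : Function.Injective φ) (hopen : IsOpen (Set.range φ)) :
    IsFiniteEtale (ContAction.res FintypeCat.{u} φ) := by
  classical
  let U : Subgroup G := φ.toMonoidHom.range
  have hUeq : (U : Set G) = Set.range φ := MonoidHom.coe_range φ.toMonoidHom
  have hU : IsOpen (U : Set G) := by rw [hUeq]; exact hopen
  haveI : Finite (G ⧸ U) := Subgroup.quotient_finite_of_isOpen U hU
  have hinj' : Function.Injective φ.toMonoidHom := hinj
  let e₀ : H ≃* U := MonoidHom.ofInjective hinj'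
  have he₀ : Continuous e₀ := by
    refine Continuous.subtype_mk ?_ _
    exact φ.continuous
  let eₜ : H ≃ₜ U := Continuous.homeoOfEquivCompactToT2 (f := e₀.toEquiv) he₀
  let e : H ≃ₜ* U :=
    { e₀ with
      continuous_toFun := he₀
      continuous_invFun := eₜ.symm.continuous }
  let e' : H →ₜ* U := e
  have hφ : φ = (inclHom U).comp e' := by
    ext h
    rfl
  haveI : (ContAction.res FintypeCat.{u} e').IsEquivalence :=
    inferInstanceAs (ContAction.resEquiv FintypeCat.{u} e).functor.IsEquivalence
  refine ⟨quotObj U hU, fiber U hU ⋙ ContAction.res FintypeCat.{u} e', inferInstance, ⟨?_⟩⟩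
  exact (ContAction.resCongr FintypeCat.{u} φ ((inclHom U).comp e') hφ).trans
    ((ContAction.resComp FintypeCat.{u} e' (inclHom U)).trans
      ((Functor.isoWhiskerRight (starFiberIso U hU).symm (ContAction.res FintypeCat.{u} e')).trans
        (Functor.associator _ _ _)))

end ResFiniteEtale

/-! ### Rmk 1.2.2.1 (⇐) for abstract connected anabelioids -/

section Abstract

variable {C : Type u} [Category.{u} C] [GaloisCategory C] {D : Type u} [Category.{u} D]
  [GaloisCategory D] (Q : C ⥤ D) [PreservesFiniteLimits Q] [PreservesFiniteColimits Q]
  (FD : D ⥤ FintypeCat.{u}) [FiberFunctor FD]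

/-- `B(Π)` for profinite `Π = Aut F` has binary products (it is a Galois category,
`galoisCategory_bCat`). [cite: MochizukiGeoAn2004, §1.1 p.9] -/
theorem hasBinaryProducts_bCat_aut (F : D ⥤ FintypeCat.{u}) [FiberFunctor F] :
    HasBinaryProducts (BCat (Aut F)) := by
  letI := galoisCategory_bCat (Aut F)
  exact hasBinaryProducts_of_hasTerminal_and_pullbacks _

/-- Transport along the identity path is the identity. [cite: MochizukiGeoAn2004, Def. 1.1.2(ii) p.10] -/
theorem autMulEquivOfIso_refl_apply {X : Type*} [Category X] (F : X) (x : Aut F) :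
    Aut.autMulEquivOfIso (Iso.refl F) x = x := by
  ext : 1
  simp [Aut.autMulEquivOfIso]

/-- **[GeoAn] Rmk 1.2.2.1 (⇐) for ABSTRACT connected anabelioids**: an exact functor `Q : C ⥤ D`
between Galois categories whose `π₁(Q) : Aut F_D → Aut (Q ⋙ F_D)` is INJECTIVE with OPEN image is
(the pull-back functor of) a finite étale morphism.  Proof: through the fibre-functor equivalences
`Q` is `res (π₁(Q))` (`compareIsoOfPath` at the identity path), which is finite étale by the
`B(–)` case; finite étaleness passes along equivalences and isomorphisms of functors.
[cite: MochizukiGeoAn2004, Rem. 1.2.2.1 p.17] -/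
theorem isFiniteEtale_of_pi1Map_injective_of_isOpen_range
    (hinj : Function.Injective (pi1Map Q FD)) (hopen : IsOpen (Set.range (pi1Map Q FD))) :
    IsFiniteEtale Q := by
  haveI : FiberFunctor (Q ⋙ FD) := fiberFunctor_comp_of_exact Q FD
  haveI := hasBinaryProducts_bCat_aut FD
  haveI := hasBinaryProducts_bCat_aut (Q ⋙ FD)
  -- `π₁(Q)` along the identity path is `π₁(Q)` itself
  let h : Aut FD →ₜ* Aut (Q ⋙ FD) := homOfPath Q FD (Iso.refl _)
  have hh : (h : Aut FD → Aut (Q ⋙ FD)) = pi1Map Q FD := by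
    funext σ
    change Aut.autMulEquivOfIso (Iso.refl _) (pi1Map Q FD σ) = _
    exact autMulEquivOfIso_refl_apply _ _
  have hres : IsFiniteEtale (ContAction.res FintypeCat.{u} h) :=
    isFiniteEtale_res_of_injective_of_isOpen' h (by rw [hh]; exact hinj) (by rw [hh]; exact hopen)
  -- transport: `functorToContAction (Q ⋙ FD) ⋙ res h ≅ Q ⋙ functorToContAction FD`
  have h1 : IsFiniteEtale (functorToContAction (Q ⋙ FD) ⋙ ContAction.res FintypeCat.{u} h) :=
    IsFiniteEtale.isEquivalence_comp _ hres
  have h2 : IsFiniteEtale (Q ⋙ functorToContAction FD) :=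
    IsFiniteEtale.of_iso (compareIsoOfPath Q FD (Iso.refl _)) h1
  have h3 : IsFiniteEtale ((Q ⋙ functorToContAction FD) ⋙ (functorToContAction FD).inv) :=
    h2.comp_isEquivalence _
  refine IsFiniteEtale.of_iso ?_ h3
  exact Functor.associator _ _ _ ≪≫
    Functor.isoWhiskerLeft Q (functorToContAction FD).asEquivalence.unitIso.symm ≪≫
      Q.rightUnitor

end Abstract

end Literature.AnabelianGeometry.Anabelioids

end
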